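import Literature.Geometry.Lorentzian.KerrDataSchwarzschildExtrinsic
import Literature.Geometry.Lorentzian.SchwarzschildKerrSchildComponents
import Literature.Geometry.Lorentzian.KerrHyperboloidalLeaves
import Literature.Geometry.Lorentzian.ChartSecondFundamentalForm
import Summits.FinalStateConjecture.FinalStateConjecture.Theorems.SwallowTheDatumKerrShieldedDataExistBridgeRadial
import HarnessLib

/-!
# `KerrShieldedDataExist`, line `plug-the-second-sheet` — the bridge annulus, II: radial maps are spacelike
# immersions with a smooth unit normal

Support file (everything proved) for stub `stub_bridgeAnnulus` of crux `stmt-FinalStateConjecture-10055`,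
continuing `…BridgeRadial`. For a profile `(τ, ϱ)` of class `C^∞` on an open set `S` of radii containing the
radii of an open set `U ⊆ E3 ∖ {0}`, with `ϱ > 0` and radial coefficient `A > 0` on `S`:

* `contDiffOn_radialMap`, `contMDiff_of_radialMap`, `mfderiv_of_radialMap_apply` — the radial map is `C^∞`
  and represents a `C^∞` map `F : U → Kerr.region 0 r₀` with the expected differential;
* `isSpacelikeImmersion_of_radialMap` — `F` is a spacelike immersion (`inducedQuad_pos`: the induced form
  `B|v|² + ((A − B)/s²)⟪y,v⟫²` is positive definite, Cauchy–Schwarz);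
* `isUnitNormal_of_radialMap`, `contDiffOn_radialNormal` — `N = A^{-1/2} Ñ` is a unit normal of sign `−1`
  along `F`, with a representative smooth on `U`.

These are exactly the hypotheses of the induced-vacuum-data packaging `stub_inducedVacuumData`.
References: O'Neill 1983, Ch. 4, pp. 97, 106–107 and Ch. 5, Lemma 5.26.
-/

-- the doubled `FinalStateConjecture` path component is the summit/problem naming scheme, not a mistake
set_option linter.dupNamespace false

noncomputable section

open Real Set Filter
open scoped Manifold ContDiff Topology InnerProductSpace
open Literature.Geometry.Lorentzian

namespace Summit.FinalStateConjecture.FinalStateConjecture.Theorems.SwallowTheDatum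

namespace Bridge

section Immersion

variable {M r₀ : ℝ} {S : Set ℝ} {U : TopologicalSpace.Opens E3} {τ ϱ τ' ϱ' : ℝ → ℝ} {Φ N : E3 → E4}
  {F : U → Kerr.region 0 r₀}

/-- The radial map with `C^∞` profile is `C^∞` at every point off the origin whose radius lies in the
(open) set where the profile is smooth. [folklore] -/
theorem contDiffAt_radialMap (hS : IsOpen S) (hτ : ContDiffOn ℝ ∞ τ S) (hϱ : ContDiffOn ℝ ∞ ϱ S)
    (hΦ : ∀ y, Φ y = τ ‖y‖ • E4.basisVector 0 + (ϱ ‖y‖ / ‖y‖) • E4.spaceEmbed y)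
    {y : E3} (hy : y ≠ 0) (hyS : ‖y‖ ∈ S) : ContDiffAt ℝ ∞ Φ y := by
  have hn : ContDiffAt ℝ ∞ (fun y : E3 ↦ ‖y‖) y := contDiffAt_norm ℝ hy
  have h1 : ContDiffAt ℝ ∞ (fun y : E3 ↦ τ ‖y‖) y := (hτ.contDiffAt (hS.mem_nhds hyS)).comp y hn
  have h2 : ContDiffAt ℝ ∞ (fun y : E3 ↦ ϱ ‖y‖) y := (hϱ.contDiffAt (hS.mem_nhds hyS)).comp y hn
  have h3 : ContDiffAt ℝ ∞ (fun y : E3 ↦ ϱ ‖y‖ / ‖y‖) y := h2.div hn (norm_ne_zero_iff.2 hy)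
  rw [show Φ = fun y ↦ τ ‖y‖ • E4.basisVector 0 + (ϱ ‖y‖ / ‖y‖) • E4.spaceEmbed y from funext hΦ]
  exact (h1.smul contDiffAt_const).add (h3.smul E4.spaceEmbed.contDiff.contDiffAt)

/-- The radial map is `C^∞` on every open set of nonzero points whose radii lie where the profile is
smooth. [folklore] -/
theorem contDiffOn_radialMap (hS : IsOpen S) (hτ : ContDiffOn ℝ ∞ τ S) (hϱ : ContDiffOn ℝ ∞ ϱ S)
    (hΦ : ∀ y, Φ y = τ ‖y‖ • E4.basisVector 0 + (ϱ ‖y‖ / ‖y‖) • E4.spaceEmbed y)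
    (hU0 : ∀ y ∈ U, y ≠ 0) (hUS : ∀ y ∈ U, ‖y‖ ∈ S) : ContDiffOn ℝ ∞ Φ (U : Set E3) := fun y hy ↦
  (contDiffAt_radialMap hS hτ hϱ hΦ (hU0 y hy) (hUS y hy)).contDiffWithinAt

/-- A map `F : U → Kerr.region 0 r₀` represented by the radial map is `C^∞` as a map of manifolds.
[folklore] -/
theorem contMDiff_of_radialMap (hS : IsOpen S) (hτ : ContDiffOn ℝ ∞ τ S) (hϱ : ContDiffOn ℝ ∞ ϱ S)
    (hΦ : ∀ y, Φ y = τ ‖y‖ • E4.basisVector 0 + (ϱ ‖y‖ / ‖y‖) • E4.spaceEmbed y)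
    (hU0 : ∀ y ∈ U, y ≠ 0) (hUS : ∀ y ∈ U, ‖y‖ ∈ S) (hF : ∀ y : U, (F y : E4) = Φ y) :
    ContMDiff 𝓘(ℝ, E3) 𝓘(ℝ, E4) ∞ F := by
  intro y
  have h1 : ContMDiffAt 𝓘(ℝ, E3) 𝓘(ℝ, E4) ∞ (fun y : U ↦ Φ y) y :=
    (OpensChart.contMDiffAt_iff y _ Φ (fun _ ↦ rfl)).2
      (contDiffAt_radialMap hS hτ hϱ hΦ (hU0 y y.2) (hUS y y.2))
  have h2 : (Subtype.val ∘ F) = fun y : U ↦ Φ y := funext hF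
  have h3 : ContMDiffAt 𝓘(ℝ, E3) 𝓘(ℝ, E4) ∞ (Subtype.val ∘ F) y := by rw [h2]; exact h1
  exact (ChartedSpace.liftPropWithinAt_subtypeVal_comp_iff F Set.univ y).mp h3

/-- The differential of `F` on a vector is that of the radial map:
`dF_y v = (τ′ ⟪y,v⟫/s) ∂_{t*} + ((ϱ′s − ϱ)⟪y,v⟫/s³)(0, y) + (ϱ/s)(0, v)`. [folklore] -/
theorem mfderiv_of_radialMap_apply
    (hΦ : ∀ y, Φ y = τ ‖y‖ • E4.basisVector 0 + (ϱ ‖y‖ / ‖y‖) • E4.spaceEmbed y)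
    (hF : ∀ y : U, (F y : E4) = Φ y) (y : U) (hy : (y : E3) ≠ 0)
    (hτ' : HasDerivAt τ (τ' ‖(y : E3)‖) ‖(y : E3)‖) (hϱ' : HasDerivAt ϱ (ϱ' ‖(y : E3)‖) ‖(y : E3)‖) (v : E3) :
    mfderiv 𝓘(ℝ, E3) 𝓘(ℝ, E4) F y v =
      (τ' ‖(y : E3)‖ * ‖(y : E3)‖⁻¹ * ⟪(y : E3), v⟫_ℝ) • E4.basisVector 0 +
        ((ϱ' ‖(y : E3)‖ * ‖(y : E3)‖ - ϱ ‖(y : E3)‖) / ‖(y : E3)‖ ^ 3 * ⟪(y : E3), v⟫_ℝ) •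
          E4.spaceEmbed (y : E3) + (ϱ ‖(y : E3)‖ / ‖(y : E3)‖) • E4.spaceEmbed v := by
  have hd := hasFDerivAt_radialMap (τ := τ) (ϱ := ϱ) hy hτ' hϱ'
  have hΦ' : Φ = fun y ↦ τ ‖y‖ • E4.basisVector 0 + (ϱ ‖y‖ / ‖y‖) • E4.spaceEmbed y := funext hΦ
  rw [OpensChart.mfderiv_apply_of_repr hF (by rw [hΦ']; exact hd.differentiableAt), hΦ']
  exact fderiv_radialMap_apply hy hτ' hϱ' v


/-- Positivity of the induced quadratic form `B‖v‖² + ((A − B)/s²)⟪y, v⟫²` for `A, B > 0`, `v ≠ 0`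
(Cauchy–Schwarz: `⟪y, v⟫² ≤ s²‖v‖²`). [folklore] -/
theorem inducedQuad_pos {A B : ℝ} (hA : 0 < A) (hB : 0 < B) {y v : E3} (hy : y ≠ 0) (hv : v ≠ 0) :
    0 < B * ⟪v, v⟫_ℝ + (A - B) / ‖y‖ ^ 2 * (⟪y, v⟫_ℝ * ⟪y, v⟫_ℝ) := by
  have hs : 0 < ‖y‖ := norm_pos_iff.2 hy
  have hvn : 0 < ‖v‖ := norm_pos_iff.2 hv
  have hcs : ⟪y, v⟫_ℝ ^ 2 ≤ ‖y‖ ^ 2 * ‖v‖ ^ 2 := by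
    have h := abs_real_inner_le_norm y v
    have h0 : 0 ≤ |⟪y, v⟫_ℝ| := abs_nonneg _
    calc ⟪y, v⟫_ℝ ^ 2 = |⟪y, v⟫_ℝ| ^ 2 := (sq_abs _).symm
      _ ≤ (‖y‖ * ‖v‖) ^ 2 := pow_le_pow_left₀ h0 h 2
      _ = ‖y‖ ^ 2 * ‖v‖ ^ 2 := by ring
  have key : B * ⟪v, v⟫_ℝ + (A - B) / ‖y‖ ^ 2 * (⟪y, v⟫_ℝ * ⟪y, v⟫_ℝ) =
      B * ((‖y‖ ^ 2 * ‖v‖ ^ 2 - ⟪y, v⟫_ℝ ^ 2) / ‖y‖ ^ 2) + A * (⟪y, v⟫_ℝ ^ 2 / ‖y‖ ^ 2) := by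
    rw [real_inner_self_eq_norm_sq]
    field_simp
    ring
  rw [key]
  have h1 : 0 ≤ B * ((‖y‖ ^ 2 * ‖v‖ ^ 2 - ⟪y, v⟫_ℝ ^ 2) / ‖y‖ ^ 2) :=
    mul_nonneg hB.le (div_nonneg (sub_nonneg.2 hcs) (sq_nonneg _))
  by_cases ha : ⟪y, v⟫_ℝ = 0
  · rw [ha]
    simp only [ne_eq, OfNat.ofNat_ne_zero, not_false_eq_true, zero_pow, sub_zero, zero_div, mul_zero,
      add_zero]
    exact mul_pos hB (div_pos (by positivity) (by positivity))
  · have h2 : 0 < A * (⟪y, v⟫_ℝ ^ 2 / ‖y‖ ^ 2) := mul_pos hA (div_pos (by positivity) (by positivity))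
    linarith

/-- **The unit normal of a radial immersion is `C^∞` on `U`** when the profile and its derivative
functions are (and `A > 0`, `ϱ > 0` there). [folklore] -/
theorem contDiffOn_radialNormal (hS : IsOpen S) (hϱ : ContDiffOn ℝ ∞ ϱ S)
    (hτ'c : ContDiffOn ℝ ∞ τ' S) (hϱ'c : ContDiffOn ℝ ∞ ϱ' S)
    (hU0 : ∀ y ∈ U, y ≠ 0) (hUS : ∀ y ∈ U, ‖y‖ ∈ S) (hpos : ∀ s ∈ S, 0 < ϱ s)
    (hA : ∀ s ∈ S, 0 < -τ' s ^ 2 + ϱ' s ^ 2 + 2 * M / ϱ s * (τ' s + ϱ' s) ^ 2)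
    (hN : ∀ y, N y = (√(-τ' ‖y‖ ^ 2 + ϱ' ‖y‖ ^ 2 + 2 * M / ϱ ‖y‖ * (τ' ‖y‖ + ϱ' ‖y‖) ^ 2))⁻¹ •
      ((-ϱ' ‖y‖ - 2 * M / ϱ ‖y‖ * (ϱ' ‖y‖ + τ' ‖y‖)) • E4.basisVector 0 +
        ((-τ' ‖y‖ + 2 * M / ϱ ‖y‖ * (ϱ' ‖y‖ + τ' ‖y‖)) / ‖y‖) • E4.spaceEmbed y)) :
    ContDiffOn ℝ ∞ N (U : Set E3) := by
  intro y hy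
  have hy0 := hU0 y hy
  have hyS := hUS y hy
  have hs0 : ‖y‖ ≠ 0 := norm_ne_zero_iff.2 hy0
  have hn : ContDiffAt ℝ ∞ (fun y : E3 ↦ ‖y‖) y := contDiffAt_norm ℝ hy0
  have hr : ContDiffAt ℝ ∞ (fun y : E3 ↦ ϱ ‖y‖) y := (hϱ.contDiffAt (hS.mem_nhds hyS)).comp y hn
  have ht' : ContDiffAt ℝ ∞ (fun y : E3 ↦ τ' ‖y‖) y := (hτ'c.contDiffAt (hS.mem_nhds hyS)).comp y hn
  have hr' : ContDiffAt ℝ ∞ (fun y : E3 ↦ ϱ' ‖y‖) y := (hϱ'c.contDiffAt (hS.mem_nhds hyS)).comp y hn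
  have hq : ContDiffAt ℝ ∞ (fun y : E3 ↦ 2 * M / ϱ ‖y‖) y := contDiffAt_const.div hr (hpos _ hyS).ne'
  have hAc : ContDiffAt ℝ ∞
      (fun y : E3 ↦ -τ' ‖y‖ ^ 2 + ϱ' ‖y‖ ^ 2 + 2 * M / ϱ ‖y‖ * (τ' ‖y‖ + ϱ' ‖y‖) ^ 2) y :=
    ((ht'.pow 2).neg.add (hr'.pow 2)).add (hq.mul ((ht'.add hr').pow 2))
  have hsq : ContDiffAt ℝ ∞
      (fun y : E3 ↦ (√(-τ' ‖y‖ ^ 2 + ϱ' ‖y‖ ^ 2 + 2 * M / ϱ ‖y‖ * (τ' ‖y‖ + ϱ' ‖y‖) ^ 2))⁻¹) y :=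
    (hAc.sqrt (hA _ hyS).ne').inv (Real.sqrt_pos.2 (hA _ hyS)).ne'
  have h0 : ContDiffAt ℝ ∞ (fun y : E3 ↦ -ϱ' ‖y‖ - 2 * M / ϱ ‖y‖ * (ϱ' ‖y‖ + τ' ‖y‖)) y :=
    hr'.neg.sub (hq.mul (hr'.add ht'))
  have h1 : ContDiffAt ℝ ∞ (fun y : E3 ↦ (-τ' ‖y‖ + 2 * M / ϱ ‖y‖ * (ϱ' ‖y‖ + τ' ‖y‖)) / ‖y‖) y :=
    (ht'.neg.add (hq.mul (hr'.add ht'))).div hn hs0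
  rw [show N = fun y ↦ (√(-τ' ‖y‖ ^ 2 + ϱ' ‖y‖ ^ 2 + 2 * M / ϱ ‖y‖ * (τ' ‖y‖ + ϱ' ‖y‖) ^ 2))⁻¹ •
      ((-ϱ' ‖y‖ - 2 * M / ϱ ‖y‖ * (ϱ' ‖y‖ + τ' ‖y‖)) • E4.basisVector 0 +
        ((-τ' ‖y‖ + 2 * M / ϱ ‖y‖ * (ϱ' ‖y‖ + τ' ‖y‖)) / ‖y‖) • E4.spaceEmbed y) from funext hN]
  exact (hsq.smul ((h0.smul contDiffAt_const).add (h1.smul E4.spaceEmbed.contDiff.contDiffAt))).contDiffWithinAt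

variable [Kerr.Facts]

/-- **A radial map with positive radial coefficient is a spacelike immersion** into the Schwarzschild
Kerr–Schild chart: `F : U → Kerr.region 0 r₀` with representative `Φ(y) = τ(s) ∂_{t*} + (ϱ(s)/s)(0, y)`,
profile `C^∞` with `ϱ > 0` and `A = −τ′² + ϱ′² + (2M/ϱ)(τ′ + ϱ′)² > 0` on the radii of `U`.
[cite: ONeill1983, Ch. 5, Lemma 5.26] -/
theorem isSpacelikeImmersion_of_radialMap (hS : IsOpen S) (hτ : ContDiffOn ℝ ∞ τ S)
    (hϱ : ContDiffOn ℝ ∞ ϱ S)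
    (hΦ : ∀ y, Φ y = τ ‖y‖ • E4.basisVector 0 + (ϱ ‖y‖ / ‖y‖) • E4.spaceEmbed y)
    (hU0 : ∀ y ∈ U, y ≠ 0) (hUS : ∀ y ∈ U, ‖y‖ ∈ S) (hF : ∀ y : U, (F y : E4) = Φ y)
    (hdτ : ∀ s ∈ S, HasDerivAt τ (τ' s) s) (hdϱ : ∀ s ∈ S, HasDerivAt ϱ (ϱ' s) s)
    (hpos : ∀ s ∈ S, 0 < ϱ s)
    (hA : ∀ s ∈ S, 0 < -τ' s ^ 2 + ϱ' s ^ 2 + 2 * M / ϱ s * (τ' s + ϱ' s) ^ 2) :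
    (Kerr.smoothMetric M 0 r₀).IsSpacelikeImmersion 𝓘(ℝ, E3) F := by
  refine ⟨contMDiff_of_radialMap hS hτ hϱ hΦ hU0 hUS hF, fun y v hv ↦ ?_⟩
  have hy0 := hU0 y y.2
  have hyS := hUS y y.2
  have hx : E4.spatial (F y : E4) = (ϱ ‖(y : E3)‖ / ‖(y : E3)‖) • (y : E3) := by
    rw [hF y]; exact spatial_radialMap hΦ y
  rw [PseudoRiemannianMetric.inducedBilin_apply, Kerr.smoothMetric_val,
    mfderiv_of_radialMap_apply hΦ hF y hy0 (hdτ _ hyS) (hdϱ _ hyS)]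
  have hgoal : 0 < Kerr.bilin M 0 (F y : E4)
      ((τ' ‖(y : E3)‖ * ‖(y : E3)‖⁻¹ * ⟪(y : E3), v⟫_ℝ) • E4.basisVector 0 +
        ((ϱ' ‖(y : E3)‖ * ‖(y : E3)‖ - ϱ ‖(y : E3)‖) / ‖(y : E3)‖ ^ 3 * ⟪(y : E3), v⟫_ℝ) •
          E4.spaceEmbed (y : E3) + (ϱ ‖(y : E3)‖ / ‖(y : E3)‖) • E4.spaceEmbed v)
      ((τ' ‖(y : E3)‖ * ‖(y : E3)‖⁻¹ * ⟪(y : E3), v⟫_ℝ) • E4.basisVector 0 +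
        ((ϱ' ‖(y : E3)‖ * ‖(y : E3)‖ - ϱ ‖(y : E3)‖) / ‖(y : E3)‖ ^ 3 * ⟪(y : E3), v⟫_ℝ) •
          E4.spaceEmbed (y : E3) + (ϱ ‖(y : E3)‖ / ‖(y : E3)‖) • E4.spaceEmbed v) := by
    rw [bilin_tangent_tangent M (hpos _ hyS) hy0 hx v v]
    exact inducedQuad_pos (hA _ hyS) (by have := hpos _ hyS; have := norm_pos_iff.2 hy0; positivity) hy0 hv
  exact hgoal

/-- **The unit normal of a radial immersion.** With `Ñ = n₀ ∂_{t*} + (n₁/s)(0, y)`,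
`n₀ = −ϱ′ − (2M/ϱ)(ϱ′ + τ′)`, `n₁ = −τ′ + (2M/ϱ)(ϱ′ + τ′)` (`= g♯(ϱ′dt* − τ′dr)`), the field
`N = A^{-1/2} Ñ` along `F` is a unit normal of sign `−1`: `g(N, dF v) = 0`, `g(N, N) = −1`.
[cite: ONeill1983, Ch. 4, pp. 106–107] -/
theorem isUnitNormal_of_radialMap
    (hΦ : ∀ y, Φ y = τ ‖y‖ • E4.basisVector 0 + (ϱ ‖y‖ / ‖y‖) • E4.spaceEmbed y)
    (hU0 : ∀ y ∈ U, y ≠ 0) (hUS : ∀ y ∈ U, ‖y‖ ∈ S) (hF : ∀ y : U, (F y : E4) = Φ y)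
    (hdτ : ∀ s ∈ S, HasDerivAt τ (τ' s) s) (hdϱ : ∀ s ∈ S, HasDerivAt ϱ (ϱ' s) s)
    (hpos : ∀ s ∈ S, 0 < ϱ s)
    (hA : ∀ s ∈ S, 0 < -τ' s ^ 2 + ϱ' s ^ 2 + 2 * M / ϱ s * (τ' s + ϱ' s) ^ 2)
    (hN : ∀ y, N y = (√(-τ' ‖y‖ ^ 2 + ϱ' ‖y‖ ^ 2 + 2 * M / ϱ ‖y‖ * (τ' ‖y‖ + ϱ' ‖y‖) ^ 2))⁻¹ •
      ((-ϱ' ‖y‖ - 2 * M / ϱ ‖y‖ * (ϱ' ‖y‖ + τ' ‖y‖)) • E4.basisVector 0 +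
        ((-τ' ‖y‖ + 2 * M / ϱ ‖y‖ * (ϱ' ‖y‖ + τ' ‖y‖)) / ‖y‖) • E4.spaceEmbed y)) :
    (Kerr.smoothMetric M 0 r₀).IsUnitNormal 𝓘(ℝ, E3) F (fun y ↦ N y) (-1) := by
  refine ⟨fun y v ↦ ?_, fun y ↦ ?_⟩
  · have hy0 := hU0 y y.2
    have hyS := hUS y y.2
    have hx : E4.spatial (F y : E4) = (ϱ ‖(y : E3)‖ / ‖(y : E3)‖) • (y : E3) := by
      rw [hF y]; exact spatial_radialMap hΦ y
    have h := bilin_rawNormal_tangent M (t₁ := τ' ‖(y : E3)‖) (r₁ := ϱ' ‖(y : E3)‖) (hpos _ hyS) hy0 hx v v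
    rw [zero_smul, add_zero] at h
    have hgoal : Kerr.bilin M 0 (F y : E4) (N y)
        ((τ' ‖(y : E3)‖ * ‖(y : E3)‖⁻¹ * ⟪(y : E3), v⟫_ℝ) • E4.basisVector 0 +
          ((ϱ' ‖(y : E3)‖ * ‖(y : E3)‖ - ϱ ‖(y : E3)‖) / ‖(y : E3)‖ ^ 3 * ⟪(y : E3), v⟫_ℝ) •
            E4.spaceEmbed (y : E3) + (ϱ ‖(y : E3)‖ / ‖(y : E3)‖) • E4.spaceEmbed v) = 0 := by
      rw [hN, map_smul, _root_.smul_apply, smul_eq_mul, h, mul_zero]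
    rw [Kerr.smoothMetric_val, mfderiv_of_radialMap_apply hΦ hF y hy0 (hdτ _ hyS) (hdϱ _ hyS)]
    exact hgoal
  · have hy0 := hU0 y y.2
    have hyS := hUS y y.2
    have hx : E4.spatial (F y : E4) = (ϱ ‖(y : E3)‖ / ‖(y : E3)‖) • (y : E3) := by
      rw [hF y]; exact spatial_radialMap hΦ y
    set A := -τ' ‖(y : E3)‖ ^ 2 + ϱ' ‖(y : E3)‖ ^ 2 +
      2 * M / ϱ ‖(y : E3)‖ * (τ' ‖(y : E3)‖ + ϱ' ‖(y : E3)‖) ^ 2 with hA_def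
    have hA0 : 0 < A := hA _ hyS
    have h := bilin_rawNormal_self M (t₁ := τ' ‖(y : E3)‖) (r₁ := ϱ' ‖(y : E3)‖) (hpos _ hyS) hy0 hx (y : E3)
    rw [zero_smul, add_zero, ← hA_def] at h
    have hs : (√A)⁻¹ * (√A)⁻¹ = A⁻¹ := by
      rw [← mul_inv, Real.mul_self_sqrt hA0.le]
    have hgoal : Kerr.bilin M 0 (F y : E4) (N y) (N y) = -1 := by
      rw [hN, map_smul, map_smul, _root_.smul_apply, smul_eq_mul, smul_eq_mul, ← hA_def, h]
      calc (√A)⁻¹ * ((√A)⁻¹ * -A) = -((√A)⁻¹ * (√A)⁻¹ * A) := by ring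
        _ = -1 := by rw [hs, inv_mul_cancel₀ hA0.ne']
    rw [Kerr.smoothMetric_val]
    exact hgoal


end Immersion

end Bridge

/-- **Registered export of this file** (sub-goal `bridge_unitNormal` of stub `stub_bridgeAnnulus`): the normalised raw normal of a radial map is a unit normal of sign `−1`, `Bridge.isUnitNormal_of_radialMap`. [cite: ONeill1983, Ch. 4, pp. 106–107] -/
theorem bridge_unitNormal :
    ∀ [Kerr.Facts] (M r₀ : ℝ) (S : Set ℝ) (U : TopologicalSpace.Opens E3) (τ ϱ τ' ϱ' : ℝ → ℝ) (Φ N : E3 → E4) (F : U → Kerr.region 0 r₀), (∀ y, Φ y = τ ‖y‖ • E4.basisVector 0 + (ϱ ‖y‖ / ‖y‖) • E4.spaceEmbed y) → (∀ y ∈ U, y ≠ 0) → (∀ y ∈ U, ‖y‖ ∈ S) → (∀ y : U, (F y : E4) = Φ y) → (∀ s ∈ S, HasDerivAt τ (τ' s) s) → (∀ s ∈ S, HasDerivAt ϱ (ϱ' s) s) → (∀ s ∈ S, 0 < ϱ s) → (∀ s ∈ S, 0 < -τ' s ^ 2 + ϱ' s ^ 2 + 2 * M / ϱ s * (τ' s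 + ϱ' s) ^ 2) → (∀ y, N y = (√(-τ' ‖y‖ ^ 2 + ϱ' ‖y‖ ^ 2 + 2 * M / ϱ ‖y‖ * (τ' ‖y‖ + ϱ' ‖y‖) ^ 2))⁻¹ • ((-ϱ' ‖y‖ - 2 * M / ϱ ‖y‖ * (ϱ' ‖y‖ + τ' ‖y‖)) • E4.basisVector 0 + ((-τ' ‖y‖ + 2 * M / ϱ ‖y‖ * (ϱ' ‖y‖ + τ' ‖y‖)) / ‖y‖) • E4.spaceEmbed y)) → (Kerr.smoothMetric M 0 r₀).IsUnitNormal 𝓘(ℝ, E3) F (fun y ↦ N y) (-1) :=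
  fun _ _ _ _ _ _ _ _ _ _ _ hΦ hU0 hUS hF hdτ hdϱ hpos hA hN ↦ Bridge.isUnitNormal_of_radialMap hΦ hU0 hUS hF hdτ hdϱ hpos hA hN

end Summit.FinalStateConjecture.FinalStateConjecture.Theorems.SwallowTheDatum

end
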